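import Mathlib
import HarnessLib

/-!
# The cyclic-shift lemma for chain integrals (Sparre Andersen / Spitzer) — tool for Tosi's Theorem 1

Topic `Literature/NumberTheory/Irrationality/Tosi2026`. Everything here is PROVED (no named facts).

Fix `l : ℕ` and think of `a : Fin l → ℝ` as the interior positions `p₁, …, p_l` of a closed chain
`p₀ = 0, p₁, …, p_l, p_{l+1} = p₀ = 0` (`pos a = Fin.cons 0 a`, indices in `Fin (l+1)` read cyclically).
For any measurable `G : ℝ → ℝ≥0∞` put `Π(a) = ∏_{i ∈ Fin (l+1)} G(p_i − p_{i+1})` (a function of the cyclic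
sequence of increments only). **The cyclic-shift lemma** (`setLIntegral_orthant_cyclicProd`):

`∫⁻_{a₁>0,…,a_l>0} Π(a) da = (1/(l+1)) · ∫⁻_{ℝ^l} Π(a) da.`

This is the integrated form of the case `r = n − 1` (`n = l + 1`) of Spitzer's combinatorial lemma
[Spitzer1956, Theorem 2.1, p. 324], read on the page (AMS open copy): "Let `x = (x₁, …, x_n)` be a vector
such that `x₁ + x₂ + ⋯ + x_n = 0`, but no other partial sum of distinct components vanishes. Let
`x_{k+n} = x_k`, and `x(k) = (x_k, x_{k+1}, …, x_{k+n})`, `k = 1, 2, …, n`. Then, for each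
`r = 0, 1, …, n − 1`, exactly one of the cyclic permutations `x(k)` of `x` is such that exactly `r` of its
successive partial sums are positive." (proof: "the successive partial sums of the components of `x(k)`
are `s_k − s_{k−1}, s_{k+1} − s_{k−1}, …` … by choosing `k` so that `s_{k−1}` is `(r+1)`st from the top").
Here the components are the increments `p_{i+1} − p_i` of the closed chain (they sum to `0`), the
hypothesis "no other partial sum vanishes" holds off a Lebesgue-null set, and the cyclic permutation
acts on `ℝ^l` as a volume-preserving linear map, so integrating gives the factor `1/(l+1)`.

Proof (written here from scratch): the "re-rooting" map
`ρ(a)_j = p_{j+2} − p₁` (positions re-based at `p₁`, i.e. `pos (ρ a) i = p_{i+1} − p₁`) is linear with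
`ρ^{l+1} = id`, hence `|det ρ| = 1` and `ρ` preserves Lebesgue measure; `Π ∘ ρ = Π` (the increments are
permuted cyclically); and `ρ⁻¹(A_k) = A_{k+1}` where `A_k = {a | p_k is the strict minimum of p₀,…,p_l}`.
The sets `A_k` are pairwise disjoint, `A_0` is the open positive orthant, and their union has null
complement (ties `p_i = p_j`, `i ≠ j`, lie in proper linear subspaces). Hence the `l+1` integrals
`∫⁻_{A_k} Π` are all equal and add up to `∫⁻ Π`.

This is the key step of an elementary proof of [Tosi2026, Theorem 1] (the basic cellular integrals
`ξ_l` in closed form): after `x_i = tanh u_i` the integrand of `ξ_l` becomes such a cyclic product with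
`G = sech` over the positive orthant (`TanhSubstitution.lean`), and the whole-space integral is a
convolution power computable by Fourier analysis (`SechChainIntegral.lean`). Also recorded: the
real-valued (Bochner) form `setIntegral_orthant_cyclicProd` for nonnegative integrable products.

## References
* F. Spitzer, *A combinatorial lemma and its application to probability theory*, Trans. AMS 82 (1956)
  323–339 (cyclic rearrangements of partial sums) [Spitzer1956].
* R. Tosi, *An explicit study of a family of cellular integrals*, arXiv:2601.00346 (2026), Theorem 1
  [Tosi2026].
-/

noncomputable section

open _root_.MeasureTheory _root_.Set _root_.Finset _root_.ENNReal

namespace Literature.NumberTheory.Irrationality.Tosi2026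

namespace CyclicShift

variable {l : ℕ}

/-! ### Positions of the closed chain and the re-rooting map -/

/-- The positions `p₀ = 0, p₁ = a₀, …, p_l = a_{l-1}` of the closed chain attached to `a : Fin l → ℝ`,
indexed by `Fin (l+1)` (read cyclically, `p_{l+1} = p₀ = 0`). [folklore] -/
def pos (a : Fin l → ℝ) : Fin (l + 1) → ℝ := Fin.cons 0 a

/-- `p₀ = 0`. [cite: Spitzer1956, Theorem 2.1 p. 324 (notation: `s₀ = 0`)] -/
@[simp] theorem pos_zero (a : Fin l → ℝ) : pos a 0 = 0 := by
  simp [pos]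

/-- `p_{j+1} = a_j`. [cite: Spitzer1956, Theorem 2.1 p. 324 (notation: the partial sums `s_k`)] -/
@[simp] theorem pos_succ (a : Fin l → ℝ) (j : Fin l) : pos a j.succ = a j := by
  simp [pos]

/-- `pos` is additive. [cite: Spitzer1956, Theorem 2.1 p. 324 (partial sums are linear)] -/
theorem pos_add (a b : Fin l → ℝ) (i : Fin (l + 1)) : pos (a + b) i = pos a i + pos b i := by
  refine Fin.cases ?_ (fun j => ?_) i <;> simp

/-- `pos` is homogeneous. [cite: Spitzer1956, Theorem 2.1 p. 324 (partial sums are linear)] -/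
theorem pos_smul (c : ℝ) (a : Fin l → ℝ) (i : Fin (l + 1)) : pos (c • a) i = c * pos a i := by
  refine Fin.cases ?_ (fun j => ?_) i <;> simp

/-- Each position is a measurable function of `a`. [cite: Spitzer1956, Theorem 2.1 p. 324 (partial sums; measurability for the integrated form)] -/
theorem measurable_pos (i : Fin (l + 1)) : Measurable fun a : Fin l → ℝ => pos a i := by
  refine Fin.cases ?_ (fun j => ?_) i
  · simp
  · simpa using measurable_pi_apply j

/-- The positions of the point `a_j = j + 1` are `p_i = i`; used to see that the tie sets are proper
subspaces. [cite: Spitzer1956, Theorem 2.1 p. 324 (hypothesis "no other partial sum vanishes": a witness)] -/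
theorem pos_natCast (i : Fin (l + 1)) : pos (fun j : Fin l => ((j : ℕ) : ℝ) + 1) i = ((i : ℕ) : ℝ) := by
  refine Fin.cases ?_ (fun j => ?_) i
  · simp
  · simp

/-- The **re-rooting map** `ρ(a)_j = p_{j+2} − p₁` (indices of `p` cyclic in `Fin (l+1)`): the chain
re-based at its first interior point. [folklore] -/
def rot (a : Fin l → ℝ) : Fin l → ℝ := fun j => pos a (j.succ + 1) - pos a 1

/-- Positions of the re-rooted chain: `pos (ρ a) i = p_{i+1} − p₁`. [cite: Spitzer1956, Theorem 2.1 p. 324, proof ("the successive partial sums of x(k) are s_k − s_{k−1}, …")] -/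
theorem pos_rot (a : Fin l → ℝ) (i : Fin (l + 1)) : pos (rot a) i = pos a (i + 1) - pos a 1 := by
  refine Fin.cases ?_ (fun j => ?_) i
  · simp
  · simp [rot]

/-- The index shift `c(k) = k mod (l+1)` as an element of `Fin (l+1)`, by recursion (`c(k+1) = c(k) + 1`).
[folklore] -/
def shiftIdx (l : ℕ) : ℕ → Fin (l + 1)
  | 0 => 0
  | k + 1 => shiftIdx l k + 1

/-- `c(k) = k mod (l+1)`. [cite: Spitzer1956, Theorem 2.1 p. 324 (indices mod n: `x_{k+n} = x_k`)] -/
theorem val_shiftIdx (k : ℕ) : (shiftIdx l k : ℕ) = k % (l + 1) := by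
  induction k with
  | zero => simp [shiftIdx]
  | succ k ih =>
    simp only [shiftIdx, Fin.val_add, ih]
    rw [Fin.val_one', Nat.add_mod_mod, Nat.mod_add_mod]

/-- `c(l+1) = 0`. [cite: Spitzer1956, Theorem 2.1 p. 324 (indices mod n: `x_{k+n} = x_k`)] -/
theorem shiftIdx_succ_self : shiftIdx l (l + 1) = 0 := by
  ext
  rw [val_shiftIdx]
  simp

/-- `c(k) = k` for `k ≤ l`, stated for `k : Fin (l+1)`. [cite: Spitzer1956, Theorem 2.1 p. 324 (indices mod n: `x_{k+n} = x_k`)] -/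
theorem shiftIdx_val (k : Fin (l + 1)) : shiftIdx l (k : ℕ) = k := by
  ext
  rw [val_shiftIdx]
  exact Nat.mod_eq_of_lt k.isLt

/-- Positions after `k` re-rootings: `pos (ρ^k a) i = p_{i+k} − p_k`. [cite: Spitzer1956, Theorem 2.1 p. 324, proof (partial sums of the k-th cyclic permutation)] -/
theorem pos_rot_iterate (a : Fin l → ℝ) (k : ℕ) (i : Fin (l + 1)) :
    pos (rot^[k] a) i = pos a (i + shiftIdx l k) - pos a (shiftIdx l k) := by
  induction k generalizing i with
  | zero => simp [shiftIdx]
  | succ k ih =>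
    rw [Function.iterate_succ_apply', pos_rot, ih, ih]
    simp only [shiftIdx]
    rw [show i + 1 + shiftIdx l k = i + (shiftIdx l k + 1) by abel,
      show (1 : Fin (l + 1)) + shiftIdx l k = shiftIdx l k + 1 by abel]
    ring

/-- `a` is recovered from its positions. [cite: Spitzer1956, Theorem 2.1 p. 324 (a vector is determined by its partial sums)] -/
theorem eq_of_pos_eq {a b : Fin l → ℝ} (h : ∀ i, pos a i = pos b i) : a = b := by
  funext j
  simpa using h j.succ

/-- The re-rooting map has order dividing `l+1`: `ρ^{l+1} = id`. [cite: Spitzer1956, Theorem 2.1 p. 324 (`x(k)`, `k = 1,…,n`: the n cyclic permutations)] -/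
theorem rot_iterate_succ_self (a : Fin l → ℝ) : rot^[l + 1] a = a := by
  apply eq_of_pos_eq
  intro i
  rw [pos_rot_iterate, shiftIdx_succ_self]
  simp

/-- The re-rooting map as a linear map. [folklore] -/
def rotL (l : ℕ) : (Fin l → ℝ) →ₗ[ℝ] (Fin l → ℝ) where
  toFun := rot
  map_add' a b := by
    funext j
    simp only [rot, Pi.add_apply, pos_add]
    ring
  map_smul' c a := by
    funext j
    simp only [rot, Pi.smul_apply, pos_smul, smul_eq_mul, RingHom.id_apply]
    ring

/-- `rotL` is `rot`. [cite: Spitzer1956, Theorem 2.1 p. 324 (cyclic permutation as a linear map)] -/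
@[simp] theorem rotL_apply (a : Fin l → ℝ) : rotL l a = rot a := rfl

/-- `rotL^{l+1} = 1`. [cite: Spitzer1956, Theorem 2.1 p. 324 (the cyclic permutation has order n)] -/
theorem rotL_pow_succ_self : rotL l ^ (l + 1) = 1 := by
  apply LinearMap.ext
  intro a
  rw [Module.End.pow_apply, Module.End.one_apply]
  exact rot_iterate_succ_self a

/-- `|det ρ| = 1`. [cite: Spitzer1956, Theorem 2.1 p. 324 (integrated form: the cyclic permutation is unimodular)] -/
theorem abs_det_rotL : |LinearMap.det (rotL l)| = 1 := by
  have h : LinearMap.det (rotL l) ^ (l + 1) = 1 := by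
    rw [← map_pow, rotL_pow_succ_self, map_one]
  have h' : |LinearMap.det (rotL l)| ^ (l + 1) = 1 := by
    rw [pow_abs, h, abs_one]
  exact (pow_eq_one_iff_of_nonneg (abs_nonneg _) (Nat.succ_ne_zero l)).mp h'

/-- The re-rooting map preserves Lebesgue measure on `ℝ^l`. [cite: Spitzer1956, Theorem 2.1 p. 324 (integrated form: the cyclic permutation preserves volume)] -/
theorem measurePreserving_rot : MeasurePreserving (rot : (Fin l → ℝ) → Fin l → ℝ) volume volume := by
  have hdet : LinearMap.det (rotL l) ≠ 0 := by
    intro h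
    have := abs_det_rotL (l := l)
    rw [h, abs_zero] at this
    exact zero_ne_one this
  have hmap := Real.map_linearMap_volume_pi_eq_smul_volume_pi hdet
  rw [abs_inv, abs_det_rotL, inv_one, ENNReal.ofReal_one, one_smul] at hmap
  exact ⟨(rotL l).continuous_of_finiteDimensional.measurable, hmap⟩

/-! ### The cells `A_k` -/

/-- `A_k = {a | p_k < p_i for all i ≠ k}`: the position `p_k` is the strict minimum of the chain.
[folklore] -/
def cell (k : Fin (l + 1)) : Set (Fin l → ℝ) := {a | ∀ i, i ≠ k → pos a k < pos a i}

/-- `A_0` is the open positive orthant. [cite: Spitzer1956, Theorem 2.1 p. 324 (case r = n − 1: all successive partial sums positive)] -/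
theorem cell_zero : cell (0 : Fin (l + 1)) = {a : Fin l → ℝ | ∀ j, 0 < a j} := by
  ext a
  simp only [cell, mem_setOf_eq]
  constructor
  · intro h j
    have := h j.succ (Fin.succ_ne_zero j)
    simpa using this
  · intro h i hi
    obtain ⟨j, rfl⟩ := Fin.exists_succ_eq.mpr hi
    simpa using h j

/-- The cells are measurable. [cite: Spitzer1956, Theorem 2.1 p. 324 (integrated form: measurability of the events)] -/
theorem measurableSet_cell (k : Fin (l + 1)) : MeasurableSet (cell (l := l) k) := by
  have : cell (l := l) k = ⋂ i : Fin (l + 1), {a | i ≠ k → pos a k < pos a i} := by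
    ext a; simp [cell]
  rw [this]
  refine MeasurableSet.iInter fun i => ?_
  by_cases hi : i = k
  · have : {a : Fin l → ℝ | i ≠ k → pos a k < pos a i} = univ := by
      ext a; simp [hi]
    rw [this]; exact MeasurableSet.univ
  · have : {a : Fin l → ℝ | i ≠ k → pos a k < pos a i} = {a | pos a k < pos a i} := by
      ext a; simp [hi]
    rw [this]
    exact measurableSet_lt (measurable_pos k) (measurable_pos i)

/-- The cells are pairwise disjoint. [cite: Spitzer1956, Theorem 2.1 p. 324 ("in one and only one way")] -/
theorem disjoint_cell {k m : Fin (l + 1)} (h : k ≠ m) : Disjoint (cell (l := l) k) (cell m) := by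
  rw [Set.disjoint_left]
  intro a hk hm
  have h1 := hk m (Ne.symm h)
  have h2 := hm k h
  exact lt_asymm h1 h2

/-- Re-rooting shifts the cells: `ρ⁻¹(A_k) = A_{k+1}`. [cite: Spitzer1956, Theorem 2.1 p. 324, proof ("by choosing k so that s_{k−1} is (r+1)st from the top")] -/
theorem preimage_rot_cell (k : Fin (l + 1)) : rot ⁻¹' cell (l := l) k = cell (k + 1) := by
  ext a
  simp only [Set.mem_preimage, cell, Set.mem_setOf_eq, pos_rot, sub_lt_sub_iff_right]
  constructor
  · intro h i hi
    have := h (i - 1) (by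
      intro h'
      apply hi
      rw [← h', sub_add_cancel])
    simpa using this
  · intro h i hi
    exact h (i + 1) (by
      intro h'
      exact hi (add_right_cancel h'))

/-- Outside the cells two positions tie. [cite: Spitzer1956, Theorem 2.1 p. 324 ("exactly one of the cyclic permutations", existence)] -/
theorem exists_pos_eq_of_not_mem_iUnion {a : Fin l → ℝ} (ha : a ∉ ⋃ k, cell k) :
    ∃ i j : Fin (l + 1), i ≠ j ∧ pos a i = pos a j := by
  by_contra hne
  push Not at hne
  obtain ⟨k, -, hk⟩ := Finset.exists_min_image Finset.univ (pos a) Finset.univ_nonempty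
  apply ha
  rw [mem_iUnion]
  refine ⟨k, fun i hi => ?_⟩
  exact lt_of_le_of_ne (hk i (Finset.mem_univ i)) (hne k i (Ne.symm hi))

/-- A tie `p_i = p_j` (`i ≠ j`) is a Lebesgue-null event. [cite: Spitzer1956, Theorem 2.1 p. 324 (hypothesis "no other partial sum vanishes" holds a.e.)] -/
theorem volume_pos_eq_pos (i j : Fin (l + 1)) (hij : i ≠ j) :
    volume {a : Fin l → ℝ | pos a i = pos a j} = 0 := by
  -- the tie set is the kernel of a nonzero linear functional, a proper subspace
  let φ : (Fin l → ℝ) →ₗ[ℝ] ℝ :=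
    { toFun := fun a => pos a i - pos a j
      map_add' := fun a b => by simp only [pos_add]; ring
      map_smul' := fun c a => by simp only [pos_smul, smul_eq_mul, RingHom.id_apply]; ring }
  have hker : {a : Fin l → ℝ | pos a i = pos a j} = (LinearMap.ker φ : Set (Fin l → ℝ)) := by
    ext a
    simp only [mem_setOf_eq, SetLike.mem_coe, LinearMap.mem_ker, φ, LinearMap.coe_mk,
      AddHom.coe_mk, sub_eq_zero]
  have htop : LinearMap.ker φ ≠ ⊤ := by
    intro h
    have hmem : (fun m : Fin l => ((m : ℕ) : ℝ) + 1) ∈ LinearMap.ker φ := by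
      rw [h]; exact Submodule.mem_top
    rw [LinearMap.mem_ker] at hmem
    simp only [φ, LinearMap.coe_mk, AddHom.coe_mk, pos_natCast, sub_eq_zero] at hmem
    exact hij (Fin.ext (by exact_mod_cast hmem))
  rw [hker]
  exact Measure.addHaar_submodule volume _ htop

/-- The union of the cells has null complement. [cite: Spitzer1956, Theorem 2.1 p. 324 (hypothesis "no other partial sum vanishes" holds a.e.)] -/
theorem volume_compl_iUnion_cell : volume (⋃ k : Fin (l + 1), cell (l := l) k)ᶜ = 0 := by
  apply measure_mono_null (t := ⋃ i : Fin (l + 1), ⋃ j : Fin (l + 1),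
      {a : Fin l → ℝ | i ≠ j ∧ pos a i = pos a j})
  · intro a ha
    obtain ⟨i, j, hij, h⟩ := exists_pos_eq_of_not_mem_iUnion ha
    simp only [mem_iUnion, mem_setOf_eq]
    exact ⟨i, j, hij, h⟩
  · refine measure_iUnion_null fun i => measure_iUnion_null fun j => ?_
    by_cases hij : i = j
    · have : {a : Fin l → ℝ | i ≠ j ∧ pos a i = pos a j} = ∅ := by
        ext a; simp [hij]
      rw [this]; exact measure_empty
    · have : {a : Fin l → ℝ | i ≠ j ∧ pos a i = pos a j} = {a | pos a i = pos a j} := by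
        ext a; simp [hij]
      rw [this]
      exact volume_pos_eq_pos i j hij

/-! ### Cyclic products and the lemma -/

/-- The cyclic product `Π(a) = ∏_{i ∈ Fin (l+1)} G(p_i − p_{i+1})` attached to the closed chain.
[folklore] -/
def cyclicProd (G : ℝ → ℝ≥0∞) (a : Fin l → ℝ) : ℝ≥0∞ :=
  ∏ i : Fin (l + 1), G (pos a i - pos a (i + 1))

/-- The cyclic product is measurable. [cite: Spitzer1956, Theorem 2.1 p. 324 (integrated form: measurability)] -/
theorem measurable_cyclicProd {G : ℝ → ℝ≥0∞} (hG : Measurable G) :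
    Measurable (cyclicProd (l := l) G) := by
  unfold cyclicProd
  refine Finset.measurable_prod _ fun i _ => ?_
  exact hG.comp ((measurable_pos i).sub (measurable_pos (i + 1)))

/-- The cyclic product is invariant under re-rooting. [cite: Spitzer1956, Theorem 2.1 p. 324 (a function of the cyclically permuted vector x(k))] -/
theorem cyclicProd_rot (G : ℝ → ℝ≥0∞) (a : Fin l → ℝ) : cyclicProd G (rot a) = cyclicProd G a := by
  unfold cyclicProd
  simp only [pos_rot, sub_sub_sub_cancel_right]
  exact Fintype.prod_equiv (Equiv.addRight 1) _ _ (fun i => by simp [add_assoc])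

/-- All cells carry the same integral. [cite: Spitzer1956, Theorem 2.1 p. 324 (integrated form: each cyclic permutation carries the same mass)] -/
theorem setLIntegral_cell_eq {G : ℝ → ℝ≥0∞} (hG : Measurable G) (k : Fin (l + 1)) :
    ∫⁻ a in cell k, cyclicProd G a = ∫⁻ a in cell (0 : Fin (l + 1)), cyclicProd (l := l) G a := by
  have step : ∀ m : Fin (l + 1),
      ∫⁻ a in cell m, cyclicProd G a = ∫⁻ a in cell (m + 1), cyclicProd (l := l) G a := by
    intro m
    rw [← (measurePreserving_rot (l := l)).setLIntegral_comp_preimage (measurableSet_cell m)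
      (measurable_cyclicProd hG), preimage_rot_cell]
    simp only [cyclicProd_rot]
  have key : ∀ n : ℕ, ∫⁻ a in cell (shiftIdx l n), cyclicProd G a
      = ∫⁻ a in cell (0 : Fin (l + 1)), cyclicProd (l := l) G a := by
    intro n
    induction n with
    | zero => simp [shiftIdx]
    | succ n ih => rw [shiftIdx, ← step, ih]
  rw [← shiftIdx_val k]
  exact key k

/-- **Cyclic-shift lemma** (Sparre Andersen / Spitzer, continuous form): the integral of a cyclic
product over the positive orthant is `1/(l+1)` of its integral over `ℝ^l`. [cite: Spitzer1956, Theorem 2.1 p. 324 (case r = n − 1, integrated over ℝ^{n−1}: mass 1/n)] -/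
theorem setLIntegral_orthant_cyclicProd {G : ℝ → ℝ≥0∞} (hG : Measurable G) :
    ∫⁻ a in {a : Fin l → ℝ | ∀ j, 0 < a j}, cyclicProd G a
      = (∫⁻ a, cyclicProd (l := l) G a) / (l + 1 : ℝ≥0∞) := by
  rw [← cell_zero]
  have htot : ∫⁻ a, cyclicProd (l := l) G a
      = (l + 1 : ℝ≥0∞) * ∫⁻ a in cell (0 : Fin (l + 1)), cyclicProd (l := l) G a := by
    rw [← lintegral_add_compl (μ := volume) (cyclicProd (l := l) G)
      (MeasurableSet.iUnion (measurableSet_cell (l := l)))]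
    rw [setLIntegral_measure_zero _ _ volume_compl_iUnion_cell, add_zero]
    rw [lintegral_iUnion measurableSet_cell
      (fun k m hkm => disjoint_cell hkm) (cyclicProd G)]
    rw [tsum_fintype]
    simp only [setLIntegral_cell_eq hG]
    rw [Finset.sum_const, Finset.card_univ, Fintype.card_fin, nsmul_eq_mul]
    push_cast
    ring
  rw [htot]
  have h1 : (l + 1 : ℝ≥0∞) ≠ 0 := by positivity
  have h2 : (l + 1 : ℝ≥0∞) ≠ ⊤ := by
    have : (l + 1 : ℝ≥0∞) = ((l + 1 : ℕ) : ℝ≥0∞) := by norm_cast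
    rw [this]; exact ENNReal.natCast_ne_top _
  rw [mul_comm]
  exact (ENNReal.mul_div_cancel_right h1 h2).symm


/-- **Cyclic-shift lemma, real-valued form**: for a measurable `g ≥ 0` whose cyclic product is
integrable on `ℝ^l`, the Bochner integral over the positive orthant is `1/(l+1)` of the whole
integral. [cite: Spitzer1956, Theorem 2.1 p. 324 (case r = n − 1, integrated over ℝ^{n−1}: mass 1/n)] -/
theorem setIntegral_orthant_cyclicProd {g : ℝ → ℝ} (hg : Measurable g) (hg0 : ∀ t, 0 ≤ g t)
    (hint : Integrable (fun a : Fin l → ℝ => ∏ i : Fin (l + 1), g (pos a i - pos a (i + 1)))) :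
    ∫ a in {a : Fin l → ℝ | ∀ j, 0 < a j}, ∏ i : Fin (l + 1), g (pos a i - pos a (i + 1))
      = (∫ a, ∏ i : Fin (l + 1), g (pos a i - pos a (i + 1))) / (l + 1) := by
  set F : (Fin l → ℝ) → ℝ := fun a => ∏ i : Fin (l + 1), g (pos a i - pos a (i + 1)) with hF
  have hF0 : ∀ a, 0 ≤ F a := fun a => Finset.prod_nonneg fun i _ => hg0 _
  have hG : Measurable fun t => ENNReal.ofReal (g t) := ENNReal.measurable_ofReal.comp hg
  have hofReal : ∀ a, ENNReal.ofReal (F a) = cyclicProd (fun t => ENNReal.ofReal (g t)) a := by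
    intro a
    simp only [hF, cyclicProd]
    exact ENNReal.ofReal_prod_of_nonneg fun i _ => hg0 _
  rw [integral_eq_lintegral_of_nonneg_ae (ae_of_all _ hF0) hint.aestronglyMeasurable.restrict,
    integral_eq_lintegral_of_nonneg_ae (ae_of_all _ hF0) hint.aestronglyMeasurable]
  simp_rw [hofReal]
  rw [setLIntegral_orthant_cyclicProd hG, ENNReal.toReal_div]
  congr 1

end CyclicShift

end Literature.NumberTheory.Irrationality.Tosi2026
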